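/-
Copyright: the m5 harness (cell B2b-5 `b2b-lgcu-borel`, generation 22).  Sorry-free; axioms: propext,
Classical.choice, Quot.sound.  VALUE = THEOREM (a budget-free, TPP-free configuration exclusion on the
level-one slice), NOT summit progress: the crux `SubgroupIdentityDesigns`
(stmt-MatrixMultiplication-14079) is untouched and remains open.
-/
import Mathlib
import Literature.NumberTheory.GaloisRepresentations.OddSubgroupCartanNormalizerGL2Fp
import Summits.MatrixMultiplication.MatrixMultiplication.Theorems.SubgroupIdentityDesigns.Negative.NonsquareReflectionsFour

/-!
# Square reflections: `Ω₃(𝔽_p) × ⟨−1⟩` and its higher-dimensional analogues lie in no member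

Route `LevelGradedCohnUmans`, crux `SubgroupIdentityDesigns`, level-one slice, `m ≥ 3`.

The mirror image of `NonsquareReflections` / `NonsquareReflectionsFour` for the OTHER spinor class:
the reflections `R_b = 1 − (2/Q(b)) b bᵀ` with `Q(b) = b ⬝ b` a NON-ZERO SQUARE.  In `𝔽_p³` they
generate `Ω₃(𝔽_p) × ⟨−1⟩ ≅ PSL₂(𝔽_p) × C₂` for `p ≥ 5` (`−1 = R_{e₁}R_{e₂}R_{e₃}`; the `−R_b` are
the involutions of `Ω₃`; order `8` at `p = 3`) — the third order-`120` non-carrier class of the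
completed `(3,5)` catalogue (not minimal there), a non-carrier for every odd `p ≤ 23`
(code/g22/signed_orthogonal_family.py of the cell: `2,3,3,4,5,6,6,7` irreducibles missing).

**COVER LEMMAS.**  `exists_orth_square` (`m = 3`, `−1 = i²`, i.e. `p ≡ 1 (mod 4)`): every `u ≠ 0`
has some `b ⊥ u` with `Q(b)` a non-zero square (`Q(u) = 0`: `b = u × e_i`, `Q(b) = −u_i² = (i u_i)²`;
else with `D = Q(u) − u_i² ≠ 0`, `c = u × e_i`, `d = u_i u − Q(u) e_i`: `b = c` if `D` is a square,
`b = d` (`Q(d) = Q(u)·D`, a product of two non-squares — `FLS2015.isSquare_mul_of_not_isSquare`) if neither `D` nor `Q(u)`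
is, `b = x c + (y/s) d` with `x² + y² = D`, `Q(u) = s²`, `Q(b) = D²` otherwise).
`exists_orth_square4` (`m = 4`, EVERY odd `p`, every `u`): with `a² + b² = −1` (`ZMod.sq_add_sq`) the
HYPERBOLIC BASIS `f₁ = (1,a,b,0)`, `g₁ = (1,−a,−b,0)`, `f₂ = (0,b,−a,1)`, `g₂ = (0,−b,a,1)` gives
`Q(x f₁ + y g₁ + z f₂ + t g₂) = 4(xy + zt)`; take `(z,t) = (1,1)` and solve the linear condition
`⊥ u` for `x` or `y`, or `(x,y,z,t) = (1,1,0,0)`: `Q = 4 = 2²`.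

**THEOREM** (every `ε`, no TPP, no budget).  No member of a triple `(H₁,H₂,H₃) ≤ GL_m(𝔽_p)³`
carrying a level-one identity design contains all square reflections of `𝔽_p^m` — for `p ≡ 1
(mod 4)` when `m ≥ 3` (`no_design_sq_mem₁/₂/₃_of_three_le`; in particular no member contains
`Ω₃(𝔽_p) × ⟨−1⟩ ⊕ 1`), and for every odd `p` when `m ≥ 4` (`no_design_sq_mem₁/₂/₃_of_four_le`);
cover forms `no_design_sq_of_cover` (`GL₃`), `no_design_sq4_of_cover` (`GL₄`).  Proof: the generic fix-cover `no_design_of_sqFixCover` (determinant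
cover, `GLmLevelOneCertificates.no_levelOne_design_of_detFixers_gl`) and the cover lemmas.

WHAT IS LEFT.  For `p ≡ 3 (mod 4)`, `m = 3`, the isotropic vectors are fixed by no square reflection
(`Q ≡ −u_i²` on `u^⊥`, a non-square) and `Ω₃ × ⟨−1⟩` has no determinant cover; it is still a
non-carrier (`p = 3, 7, 11, 19, 23`: `2, 3, 4, 6, 7` irreducibles missing) — open, like the
non-square class `K_p⁻` for `p ≡ 1 (mod 4)`.  Together with `NonsquareReflections(Four)`: for every
odd `p` and every `m ≥ 3`, no member contains all reflections of `𝔽_p^m` of one square class,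
except possibly the class whose sign is `−χ(−1)` in dimension `3`.

DATA (code/g22/square_reflection_check.py/.out of the cell, exact): `⟨R_b : Q(b) square⟩ = Ω₃ × ⟨−1⟩`
(order `p(p²−1)`) for `p = 5, 7, 11, 13`, order `8` for `p = 3`; fix-cover of `𝔽_p³ ∖ 0` iff
`p ≡ 1 (mod 4)` (failures = the isotropic vectors); in `𝔽_p⁴`: order `14400` (index `2` in `O₄⁺`) at
`p = 5`, `192` at `p = 3`, fix-cover for `p = 3, 5`; `−1 ∈ ⟨R_b⟩` throughout.

HONEST SCOPE.  Configuration exclusions; no `(p,m,ε)` cell is emptied.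
-/

set_option linter.dupNamespace false

noncomputable section

open scoped BigOperators Classical Matrix

namespace Summit.MatrixMultiplication.MatrixMultiplication.Theorems.SubgroupIdentityDesigns.Negative
namespace NonsquareReflections

open Summit.MatrixMultiplication.MatrixMultiplication.Theorems.LieRankDesigns.Negative (GLm Mat)
open SummandTransport (emb design_comap)
open Literature.NumberTheory.GaloisRepresentations.FLS2015 (isSquare_mul_of_not_isSquare)
open Literature.NumberTheory.EllipticCurves.BinaryQuartic (two_ne_zero_zmod)
open Literature.NumberTheory.EllipticCurves.ModularForms (four_ne_zero_zmod)
open DihedralUnipotent (neg_one_ne_one)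

variable {p : ℕ} [hp : Fact p.Prime] {m : ℕ}

/-! ## The square reflection group and the generic fix-cover -/

/-- The subgroup generated by the SQUARE reflections (`= Ω₃ × ⟨−1⟩` for `m = 3`, `p ≥ 5`). -/
def sqReflGroup (p m : ℕ) [Fact p.Prime] : Subgroup (GLm p m) :=
  Subgroup.closure {g | ∃ b : Fin m → ZMod p, b ⬝ᵥ b ≠ 0 ∧ IsSquare (b ⬝ᵥ b) ∧ g = refl b}

/-- The square reflections of a member generate a subgroup of it. -/
theorem sqReflGroup_le {H : Subgroup (GLm p m)}
    (h : ∀ b : Fin m → ZMod p, b ⬝ᵥ b ≠ 0 → IsSquare (b ⬝ᵥ b) → refl b ∈ H) :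
    sqReflGroup p m ≤ H := by
  refine (Subgroup.closure_le H).mpr ?_
  rintro _ ⟨b, hb0, hb, rfl⟩
  exact h b hb0 hb

section General

variable [NeZero m] {H₁ H₂ H₃ : Subgroup (GLm p m)}

/-- **GENERIC COVER FORM, square class** (any `m ≥ 1`, `−1 ≠ 1`).  A fix-cover of `𝔽_p^m ∖ 0` by
square reflections excludes `sqReflGroup ∖ 1 ⊆ H₁H₂H₃`. -/
theorem no_design_of_sqFixCover (hm1' : (-1 : ZMod p) ≠ 1)
    (hcov : ∀ u : Fin m → ZMod p, u ≠ 0 →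
      ∃ b : Fin m → ZMod p, b ⬝ᵥ u = 0 ∧ b ⬝ᵥ b ≠ 0 ∧ IsSquare (b ⬝ᵥ b))
    (hmem : ∀ k ∈ sqReflGroup p m, k ≠ 1 → ∃ a ∈ H₁, ∃ b ∈ H₂, ∃ g ∈ H₃, a * b * g = k) :
    ¬ ∃ c : Mat p m → ℂ, (∀ M, 1 < M.rank → c M = 0) ∧
      (∑ M, c M * ZMod.stdAddChar (Matrix.trace (M * ((1 : GLm p m) : Mat p m)))) = 1 ∧
      ∀ a ∈ H₁, ∀ b ∈ H₂, ∀ g ∈ H₃, a * b * g ≠ 1 →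
        (∑ M, c M * ZMod.stdAddChar (Matrix.trace (M * ((a * b * g : GLm p m) : Mat p m)))) = 0 := by
  refine no_levelOne_design_of_detFixers_gl (sqReflGroup p m) hmem fun u hu => ?_
  obtain ⟨b, hbu, hb0, hb⟩ := hcov u hu
  refine ⟨refl b, Subgroup.subset_closure ⟨b, hb0, hb, rfl⟩, ?_, ?_⟩
  · rw [coe_refl, det_reflMat b hb0]
    exact hm1'
  · rw [coe_refl]
    exact reflMat_mulVec b u hbu

end General

/-! ## The cover of `𝔽_p³` for `p ≡ 1 (mod 4)` -/

/-- **COVER LEMMA, square class, dimension three** (`−1 = i²`, `p` odd): every `u ≠ 0` of `𝔽_p³`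
is orthogonal to some `b` with `Q(b)` a non-zero square. -/
theorem exists_orth_square {i : ZMod p} (hi : -1 = i * i) (hp2 : p ≠ 2) (u : Fin 3 → ZMod p)
    (hu : u ≠ 0) : ∃ b : Fin 3 → ZMod p, b ⬝ᵥ u = 0 ∧ b ⬝ᵥ b ≠ 0 ∧ IsSquare (b ⬝ᵥ b) := by
  set Q := u ⬝ᵥ u with hQ
  have hc_orth : ∀ i : Fin 3, (u ⨯₃ Pi.single i 1) ⬝ᵥ u = 0 := fun i => by
    rw [dotProduct_comm]; exact dot_self_cross u _
  have hc_Q : ∀ i : Fin 3, (u ⨯₃ Pi.single i 1) ⬝ᵥ (u ⨯₃ Pi.single i 1) = Q - u i * u i :=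
    fun i => by
      simp only [cross_dot_cross, dotProduct_single, single_dotProduct, Pi.single_eq_same, mul_one,
        one_mul, hQ]
  rcases eq_or_ne Q 0 with hQ0 | hQ0
  · -- isotropic `u`: `b = u × e_j`, `Q(b) = -u_j² = (i u_j)²`
    obtain ⟨j, hj⟩ : ∃ j, u j ≠ 0 := by
      by_contra h
      simp only [not_exists, not_not] at h
      exact hu (funext h)
    refine ⟨u ⨯₃ Pi.single j 1, hc_orth j, ?_, ?_⟩
    · rw [hc_Q j, hQ0, zero_sub]
      exact neg_ne_zero.mpr (mul_ne_zero hj hj)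
    · rw [hc_Q j, hQ0, zero_sub]
      exact ⟨i * u j, by linear_combination (u j * u j) * hi⟩
  · obtain ⟨j, hj⟩ : ∃ j, Q - u j * u j ≠ 0 := by
      by_contra h
      simp only [not_exists, not_not, sub_eq_zero] at h
      have h3 : Q = u 0 * u 0 + u 1 * u 1 + u 2 * u 2 := by
        rw [hQ, dotProduct, Fin.sum_univ_three]
      have h2Q : (2 : ZMod p) * Q = 0 := by
        linear_combination (h 0) + (h 1) + (h 2) - h3
      rcases mul_eq_zero.mp h2Q with h2 | h0
      · exact two_ne_zero_zmod hp2 h2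
      · exact hQ0 h0
    set D := Q - u j * u j with hD
    set c := u ⨯₃ Pi.single j 1 with hc
    set d := u j • u - Q • (Pi.single j 1 : Fin 3 → ZMod p) with hd
    have hcu : c ⬝ᵥ u = 0 := hc_orth j
    have hcc : c ⬝ᵥ c = D := hc_Q j
    have hdu : d ⬝ᵥ u = 0 := by
      rw [hd, sub_dotProduct, smul_dotProduct, smul_dotProduct, single_dotProduct, smul_eq_mul,
        smul_eq_mul, one_mul, ← hQ]
      ring
    have hce : c ⬝ᵥ Pi.single j 1 = 0 := by
      rw [hc, dotProduct_comm]; exact dot_cross_self u _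
    have hcd : c ⬝ᵥ d = 0 := by
      rw [hd, dotProduct_sub, dotProduct_smul, dotProduct_smul, hcu, hce, smul_zero, smul_zero,
        sub_zero]
    have hdd : d ⬝ᵥ d = Q * D := by
      rw [hd, sub_dotProduct, dotProduct_sub, dotProduct_sub, smul_dotProduct, smul_dotProduct,
        smul_dotProduct, smul_dotProduct, dotProduct_smul, dotProduct_smul, dotProduct_smul,
        dotProduct_smul, ← hQ, dotProduct_single, single_dotProduct, single_dotProduct,
        Pi.single_eq_same]
      simp only [smul_eq_mul, mul_one, one_mul, hD]
      ring
    by_cases hDsq : IsSquare D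
    · -- `D` a square: `b = c`
      exact ⟨c, hcu, by rw [hcc]; exact hj, by rw [hcc]; exact hDsq⟩
    · by_cases hQsq : IsSquare Q
      · -- `Q = s²`, `D` not a square: `b = x c + (y/s) d` with `x² + y² = D`, `Q(b) = D²`
        obtain ⟨s, hs⟩ := hQsq
        have hs0 : s ≠ 0 := by rintro rfl; exact hQ0 (by rw [hs, mul_zero])
        obtain ⟨x, y, hxy⟩ := ZMod.sq_add_sq p D
        have h1 : y / s * (y / s) * (s * s * D) = y * y * D := by field_simp
        have hval : (x • c + (y / s) • d) ⬝ᵥ (x • c + (y / s) • d) = D * D := by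
          rw [dot_combo c d hcd, hcc, hdd, hs, h1]
          linear_combination D * hxy
        refine ⟨x • c + (y / s) • d, ?_, ?_, ?_⟩
        · rw [add_dotProduct, smul_dotProduct, smul_dotProduct, hcu, hdu, smul_zero, smul_zero,
            add_zero]
        · rw [hval]; exact mul_ne_zero hj hj
        · rw [hval]; exact ⟨D, rfl⟩
      · -- neither `Q` nor `D` a square: `b = d`, `Q(d) = Q·D` a square
        exact ⟨d, hdu, by rw [hdd]; exact mul_ne_zero hQ0 hj,
          by rw [hdd]; exact isSquare_mul_of_not_isSquare hQsq hDsq⟩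

/-! ## The cover of `𝔽_p⁴` for every odd `p` -/

/-- **HYPERBOLIC BASIS.**  With `a² + b² = −1`, `v = x f₁ + y g₁ + z f₂ + t g₂` for
`f₁ = (1,a,b,0)`, `g₁ = (1,−a,−b,0)`, `f₂ = (0,b,−a,1)`, `g₂ = (0,−b,a,1)` has `Q(v) = 4(xy + zt)`
and `v ⬝ u = αx + βy + γz + δt`. -/
theorem hyperbolic_witness' {a b n : ZMod p} (hab : a * a + b * b = -1) (u : Fin 4 → ZMod p)
    (x y z t : ZMod p)
    (hlin : (u 0 + a * u 1 + b * u 2) * x + (u 0 - a * u 1 - b * u 2) * y +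
      (b * u 1 - a * u 2 + u 3) * z + (-b * u 1 + a * u 2 + u 3) * t = 0)
    (hq : 4 * (x * y + z * t) = n) :
    ∃ v : Fin 4 → ZMod p, v ⬝ᵥ u = 0 ∧ v ⬝ᵥ v = n := by
  refine ⟨![x + y, a * (x - y) + b * (z - t), b * (x - y) - a * (z - t), z + t], ?_, ?_⟩
  · simp only [dotProduct, Fin.sum_univ_four, Matrix.cons_val_zero, Matrix.cons_val_one,
      Matrix.cons_val]
    linear_combination hlin
  · simp only [dotProduct, Fin.sum_univ_four, Matrix.cons_val_zero, Matrix.cons_val_one,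
      Matrix.cons_val]
    linear_combination ((x - y) ^ 2 + (z - t) ^ 2) * hab + hq

/-- **COVER LEMMA, square class, dimension four** (every odd `p`): every `u ∈ 𝔽_p⁴` is orthogonal
to some `v` with `Q(v) = 4 = 2²`. -/
theorem exists_orth_square4 (hp2 : p ≠ 2) (u : Fin 4 → ZMod p) :
    ∃ v : Fin 4 → ZMod p, v ⬝ᵥ u = 0 ∧ v ⬝ᵥ v ≠ 0 ∧ IsSquare (v ⬝ᵥ v) := by
  obtain ⟨a, b, hab⟩ := ZMod.sq_add_sq p (-1)
  have hab' : a * a + b * b = -1 := by rw [← hab]; ring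
  have h4 : (4 : ZMod p) ≠ 0 := four_ne_zero_zmod hp2
  have h4sq : IsSquare (4 : ZMod p) := ⟨2, by norm_num⟩
  suffices h : ∃ v : Fin 4 → ZMod p, v ⬝ᵥ u = 0 ∧ v ⬝ᵥ v = 4 by
    obtain ⟨v, hv, hQ⟩ := h
    exact ⟨v, hv, by rw [hQ]; exact h4, by rw [hQ]; exact h4sq⟩
  by_cases hα : u 0 + a * u 1 + b * u 2 = 0
  · by_cases hβ : u 0 - a * u 1 - b * u 2 = 0
    · exact hyperbolic_witness' hab' u 1 1 0 0 (by rw [hα, hβ]; ring) (by ring)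
    · refine hyperbolic_witness' hab' u 0
        (-((b * u 1 - a * u 2 + u 3) + (-b * u 1 + a * u 2 + u 3)) / (u 0 - a * u 1 - b * u 2))
        1 1 ?_ (by ring)
      rw [hα, mul_div_cancel₀ _ hβ]
      ring
  · refine hyperbolic_witness' hab' u
      (-((b * u 1 - a * u 2 + u 3) + (-b * u 1 + a * u 2 + u 3)) / (u 0 + a * u 1 + b * u 2))
      0 1 1 ?_ (by ring)
    rw [mul_div_cancel₀ _ hα]
    ring

/-! ## The exclusions -/

section GL3

variable {H₁ H₂ H₃ : Subgroup (GLm p 3)}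

/-- **COVER FORM in `GL₃(𝔽_p)`, square class** (`p ≡ 1 mod 4`): `(Ω₃ × ⟨−1⟩) ∖ 1 ⊆ H₁H₂H₃` is
impossible for a triple carrying a level-one identity design. -/
theorem no_design_sq_of_cover (hm1 : IsSquare (-1 : ZMod p)) (hp2 : p ≠ 2)
    (hmem : ∀ k ∈ sqReflGroup p 3, k ≠ 1 → ∃ a ∈ H₁, ∃ b ∈ H₂, ∃ g ∈ H₃, a * b * g = k) :
    ¬ ∃ c : Mat p 3 → ℂ, (∀ M, 1 < M.rank → c M = 0) ∧
      (∑ M, c M * ZMod.stdAddChar (Matrix.trace (M * ((1 : GLm p 3) : Mat p 3)))) = 1 ∧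
      ∀ a ∈ H₁, ∀ b ∈ H₂, ∀ g ∈ H₃, a * b * g ≠ 1 →
        (∑ M, c M * ZMod.stdAddChar (Matrix.trace (M * ((a * b * g : GLm p 3) : Mat p 3)))) = 0 := by
  obtain ⟨i, hi⟩ := hm1
  exact no_design_of_sqFixCover (neg_one_ne_one hp2)
    (fun u hu => exists_orth_square hi hp2 u hu) hmem

end GL3

section GL4

variable {H₁ H₂ H₃ : Subgroup (GLm p 4)}

/-- **COVER FORM in `GL₄(𝔽_p)`, square class** (every odd `p`). -/
theorem no_design_sq4_of_cover (hp2 : p ≠ 2)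
    (hmem : ∀ k ∈ sqReflGroup p 4, k ≠ 1 → ∃ a ∈ H₁, ∃ b ∈ H₂, ∃ g ∈ H₃, a * b * g = k) :
    ¬ ∃ c : Mat p 4 → ℂ, (∀ M, 1 < M.rank → c M = 0) ∧
      (∑ M, c M * ZMod.stdAddChar (Matrix.trace (M * ((1 : GLm p 4) : Mat p 4)))) = 1 ∧
      ∀ a ∈ H₁, ∀ b ∈ H₂, ∀ g ∈ H₃, a * b * g ≠ 1 →
        (∑ M, c M * ZMod.stdAddChar (Matrix.trace (M * ((a * b * g : GLm p 4) : Mat p 4)))) = 0 :=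
  no_design_of_sqFixCover (neg_one_ne_one hp2) (fun u _ => exists_orth_square4 hp2 u) hmem

end GL4

/-! ## Coordinate-free forms in every dimension -/

section CoordinateFree

/-- **NO MEMBER CONTAINS ALL SQUARE REFLECTIONS OF `𝔽_p^m`, `m ≥ 3`, `p ≡ 1 (mod 4)`**:
member `1` (in particular no member contains `(Ω₃(𝔽_p) × ⟨−1⟩) ⊕ 1`). -/
theorem no_design_sq_mem₁_of_three_le (hm1 : IsSquare (-1 : ZMod p)) (hp2 : p ≠ 2) (hm : 3 ≤ m)
    {H₁ H₂ H₃ : Subgroup (GLm p m)}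
    (h₁ : ∀ b : Fin m → ZMod p, b ⬝ᵥ b ≠ 0 → IsSquare (b ⬝ᵥ b) → refl b ∈ H₁) :
    ¬ ∃ c : Mat p m → ℂ, (∀ M, 1 < M.rank → c M = 0) ∧
      (∑ M, c M * ZMod.stdAddChar (Matrix.trace (M * ((1 : GLm p m) : Mat p m)))) = 1 ∧
      ∀ a ∈ H₁, ∀ b ∈ H₂, ∀ g ∈ H₃, a * b * g ≠ 1 →
        (∑ M, c M * ZMod.stdAddChar (Matrix.trace (M * ((a * b * g : GLm p m) : Mat p m)))) = 0 := by
  obtain ⟨l, rfl⟩ := Nat.exists_eq_add_of_le hm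
  intro hdes
  refine no_design_sq_of_cover (H₁ := H₁.comap (emb finSumFinEquiv))
    (H₂ := H₂.comap (emb finSumFinEquiv)) (H₃ := H₃.comap (emb finSumFinEquiv)) hm1 hp2
    (triple_of_le₁ (sqReflGroup_le fun b hb0 hb => Subgroup.mem_comap.mpr ?_))
    (design_comap finSumFinEquiv 1 hdes)
  rw [emb_refl]
  exact h₁ _ (by rwa [extVec_dotProduct]) (by rwa [extVec_dotProduct])

/-- Member `2`, `m ≥ 3`, `p ≡ 1 (mod 4)`. -/
theorem no_design_sq_mem₂_of_three_le (hm1 : IsSquare (-1 : ZMod p)) (hp2 : p ≠ 2) (hm : 3 ≤ m)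
    {H₁ H₂ H₃ : Subgroup (GLm p m)}
    (h₂ : ∀ b : Fin m → ZMod p, b ⬝ᵥ b ≠ 0 → IsSquare (b ⬝ᵥ b) → refl b ∈ H₂) :
    ¬ ∃ c : Mat p m → ℂ, (∀ M, 1 < M.rank → c M = 0) ∧
      (∑ M, c M * ZMod.stdAddChar (Matrix.trace (M * ((1 : GLm p m) : Mat p m)))) = 1 ∧
      ∀ a ∈ H₁, ∀ b ∈ H₂, ∀ g ∈ H₃, a * b * g ≠ 1 →
        (∑ M, c M * ZMod.stdAddChar (Matrix.trace (M * ((a * b * g : GLm p m) : Mat p m)))) = 0 := by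
  obtain ⟨l, rfl⟩ := Nat.exists_eq_add_of_le hm
  intro hdes
  refine no_design_sq_of_cover (H₁ := H₁.comap (emb finSumFinEquiv))
    (H₂ := H₂.comap (emb finSumFinEquiv)) (H₃ := H₃.comap (emb finSumFinEquiv)) hm1 hp2
    (triple_of_le₂ (sqReflGroup_le fun b hb0 hb => Subgroup.mem_comap.mpr ?_))
    (design_comap finSumFinEquiv 1 hdes)
  rw [emb_refl]
  exact h₂ _ (by rwa [extVec_dotProduct]) (by rwa [extVec_dotProduct])

/-- Member `3`, `m ≥ 3`, `p ≡ 1 (mod 4)`. -/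
theorem no_design_sq_mem₃_of_three_le (hm1 : IsSquare (-1 : ZMod p)) (hp2 : p ≠ 2) (hm : 3 ≤ m)
    {H₁ H₂ H₃ : Subgroup (GLm p m)}
    (h₃ : ∀ b : Fin m → ZMod p, b ⬝ᵥ b ≠ 0 → IsSquare (b ⬝ᵥ b) → refl b ∈ H₃) :
    ¬ ∃ c : Mat p m → ℂ, (∀ M, 1 < M.rank → c M = 0) ∧
      (∑ M, c M * ZMod.stdAddChar (Matrix.trace (M * ((1 : GLm p m) : Mat p m)))) = 1 ∧
      ∀ a ∈ H₁, ∀ b ∈ H₂, ∀ g ∈ H₃, a * b * g ≠ 1 →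
        (∑ M, c M * ZMod.stdAddChar (Matrix.trace (M * ((a * b * g : GLm p m) : Mat p m)))) = 0 := by
  obtain ⟨l, rfl⟩ := Nat.exists_eq_add_of_le hm
  intro hdes
  refine no_design_sq_of_cover (H₁ := H₁.comap (emb finSumFinEquiv))
    (H₂ := H₂.comap (emb finSumFinEquiv)) (H₃ := H₃.comap (emb finSumFinEquiv)) hm1 hp2
    (triple_of_le₃ (sqReflGroup_le fun b hb0 hb => Subgroup.mem_comap.mpr ?_))
    (design_comap finSumFinEquiv 1 hdes)
  rw [emb_refl]
  exact h₃ _ (by rwa [extVec_dotProduct]) (by rwa [extVec_dotProduct])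

/-- **NO MEMBER CONTAINS ALL SQUARE REFLECTIONS OF `𝔽_p^m`, `m ≥ 4`, `p` odd**: member `1`. -/
theorem no_design_sq_mem₁_of_four_le (hp2 : p ≠ 2) (hm : 4 ≤ m) {H₁ H₂ H₃ : Subgroup (GLm p m)}
    (h₁ : ∀ b : Fin m → ZMod p, b ⬝ᵥ b ≠ 0 → IsSquare (b ⬝ᵥ b) → refl b ∈ H₁) :
    ¬ ∃ c : Mat p m → ℂ, (∀ M, 1 < M.rank → c M = 0) ∧
      (∑ M, c M * ZMod.stdAddChar (Matrix.trace (M * ((1 : GLm p m) : Mat p m)))) = 1 ∧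
      ∀ a ∈ H₁, ∀ b ∈ H₂, ∀ g ∈ H₃, a * b * g ≠ 1 →
        (∑ M, c M * ZMod.stdAddChar (Matrix.trace (M * ((a * b * g : GLm p m) : Mat p m)))) = 0 := by
  obtain ⟨l, rfl⟩ := Nat.exists_eq_add_of_le hm
  intro hdes
  refine no_design_sq4_of_cover (H₁ := H₁.comap (emb finSumFinEquiv))
    (H₂ := H₂.comap (emb finSumFinEquiv)) (H₃ := H₃.comap (emb finSumFinEquiv)) hp2
    (triple_of_le₁ (sqReflGroup_le fun b hb0 hb => Subgroup.mem_comap.mpr ?_))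
    (design_comap finSumFinEquiv 1 hdes)
  rw [emb_refl]
  exact h₁ _ (by rwa [extVec_dotProduct]) (by rwa [extVec_dotProduct])

/-- Member `2`, `m ≥ 4`, `p` odd. -/
theorem no_design_sq_mem₂_of_four_le (hp2 : p ≠ 2) (hm : 4 ≤ m) {H₁ H₂ H₃ : Subgroup (GLm p m)}
    (h₂ : ∀ b : Fin m → ZMod p, b ⬝ᵥ b ≠ 0 → IsSquare (b ⬝ᵥ b) → refl b ∈ H₂) :
    ¬ ∃ c : Mat p m → ℂ, (∀ M, 1 < M.rank → c M = 0) ∧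
      (∑ M, c M * ZMod.stdAddChar (Matrix.trace (M * ((1 : GLm p m) : Mat p m)))) = 1 ∧
      ∀ a ∈ H₁, ∀ b ∈ H₂, ∀ g ∈ H₃, a * b * g ≠ 1 →
        (∑ M, c M * ZMod.stdAddChar (Matrix.trace (M * ((a * b * g : GLm p m) : Mat p m)))) = 0 := by
  obtain ⟨l, rfl⟩ := Nat.exists_eq_add_of_le hm
  intro hdes
  refine no_design_sq4_of_cover (H₁ := H₁.comap (emb finSumFinEquiv))
    (H₂ := H₂.comap (emb finSumFinEquiv)) (H₃ := H₃.comap (emb finSumFinEquiv)) hp2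
    (triple_of_le₂ (sqReflGroup_le fun b hb0 hb => Subgroup.mem_comap.mpr ?_))
    (design_comap finSumFinEquiv 1 hdes)
  rw [emb_refl]
  exact h₂ _ (by rwa [extVec_dotProduct]) (by rwa [extVec_dotProduct])

/-- Member `3`, `m ≥ 4`, `p` odd. -/
theorem no_design_sq_mem₃_of_four_le (hp2 : p ≠ 2) (hm : 4 ≤ m) {H₁ H₂ H₃ : Subgroup (GLm p m)}
    (h₃ : ∀ b : Fin m → ZMod p, b ⬝ᵥ b ≠ 0 → IsSquare (b ⬝ᵥ b) → refl b ∈ H₃) :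
    ¬ ∃ c : Mat p m → ℂ, (∀ M, 1 < M.rank → c M = 0) ∧
      (∑ M, c M * ZMod.stdAddChar (Matrix.trace (M * ((1 : GLm p m) : Mat p m)))) = 1 ∧
      ∀ a ∈ H₁, ∀ b ∈ H₂, ∀ g ∈ H₃, a * b * g ≠ 1 →
        (∑ M, c M * ZMod.stdAddChar (Matrix.trace (M * ((a * b * g : GLm p m) : Mat p m)))) = 0 := by
  obtain ⟨l, rfl⟩ := Nat.exists_eq_add_of_le hm
  intro hdes
  refine no_design_sq4_of_cover (H₁ := H₁.comap (emb finSumFinEquiv))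
    (H₂ := H₂.comap (emb finSumFinEquiv)) (H₃ := H₃.comap (emb finSumFinEquiv)) hp2
    (triple_of_le₃ (sqReflGroup_le fun b hb0 hb => Subgroup.mem_comap.mpr ?_))
    (design_comap finSumFinEquiv 1 hdes)
  rw [emb_refl]
  exact h₃ _ (by rwa [extVec_dotProduct]) (by rwa [extVec_dotProduct])

end CoordinateFree

end NonsquareReflections
end Summit.MatrixMultiplication.MatrixMultiplication.Theorems.SubgroupIdentityDesigns.Negative

end
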